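import Summits.AtomisticToContinuum.Crystallization.Theses.GappedShellCensus
import Summits.AtomisticToContinuum.Crystallization.Theorems.GappedShellCensusCleanLimitExtractionRStubCleRGoodBall
import Summits.AtomisticToContinuum.Crystallization.Theorems.GappedShellCensusCleanLimitExtractionRStubCleRGappedOfTendsto
import Summits.AtomisticToContinuum.Crystallization.Theorems.GappedShellCensusCleanLimitExtractionRStubCleRFccHcpOfTendsto
import Summits.AtomisticToContinuum.Crystallization.Theorems.GappedShellCensusCleanLimitExtractionRStubCleRHullDictionary
import Summits.AtomisticToContinuum.Crystallization.Theorems.GappedShellCensusCleanLimitExtractionRStubCleRCleanHullElement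
import Summits.AtomisticToContinuum.Crystallization.Theorems.GappedShellCensusCleanLimitExtractionRStubCleRTrichotomyFactor

/-!
# Crux `GappedShellCensus.CleanLimitExtractionR` (stmt-AtomisticToContinuum-18072) — THE BRIDGE
# `RadialDefectsVanish → ShellTrichotomy → TornFree → FiveFoldRationingR → CleanLocalLimit`

Line `CleanLimitExtractionR_CandidateProof` (crux-ideate ideator 2's complete candidate, tree copy
`Cruxes/CleanLimitExtractionR/SketchIdeator2.lean`), ported to `Theorems/` as six stubs and this
composition:

* stub E `stub_cleRGoodBall` — ball counting with the hard core (good balls of every radius,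
  frequently, from a vanishing density of bad particles);
* stub A `stub_cleRGappedOfTendsto` — gapped-twelve is closed under local-rubber limits of
  `δ`-separated configurations (collar transfer through the Hales gap);
* stub B `stub_cleRFccHcpOfTendsto` — the `1/5`-fcc/hcp typing of rescaled shells is closed under
  the same limits (stage labelling, pigeonhole, compactness of `O(3)`);
* stub C₁ `stub_cleRCleanHullElement` — E → A → B → pattern-typed rationing → radial defects vanish
  at scale `a` → a rooted, everywhere-clean member of the ω-limit hull of `x` (compact rubber space
  `LocalConfig ℝ³`, two extractions);
* stub C₂ `stub_cleRHullDictionary` — hull membership ⇒ the matching clause of `CleanLocalLimit`;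
* stub D `stub_cleRTrichotomyFactor` — `ShellTrichotomy → TornFree → FiveFoldRationingR →`
  pattern-typed rationing (the bookkeeping identity shell-degree = common-neighbour count turns
  TornFree's `≥ 4` and FiveFoldRationingR's `≤ 4` into "neither capped nor torn", so the trichotomy
  yields branch (A) on balls of every radius).
-/

noncomputable section

namespace Summit.AtomisticToContinuum.Crystallization.Theorems

open Summit.AtomisticToContinuum.Crystallization.Theses.GappedShellCensus

/-- **`GappedShellCensus.CleanLimitExtractionR`** (item stmt-AtomisticToContinuum-18072, THE BRIDGE of
route `GappedShellCensus`): `RadialDefectsVanish → ShellTrichotomy → TornFree → FiveFoldRationingR →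
CleanLocalLimit` — the rooted clean hull element (stub C₁) fed with ball counting (E), the two
closedness statements (A, B) and the trichotomy factor (D), read through the hull dictionary (C₂). -/
theorem cleanLimitExtractionR_proof : CleanLimitExtractionR := by
  unfold CleanLimitExtractionR
  intro hRDV hST hTF hFFR x hx
  obtain ⟨a, ha1, ha2, hθ⟩ := hRDV x hx
  have ha : 0 < a := by linarith
  obtain ⟨Y, hY, h0, hclean⟩ := stub_cleRCleanHullElement x hx ha hθ
    (fun x δ hδ hsep good hbad k hk => stub_cleRGoodBall hδ hsep good hbad k hk)
    (fun S Y a δ ha hδ hS hY y r hy hyr hgood => stub_cleRGappedOfTendsto ha hδ hS hY hy hyr hgood)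
    (fun S Y a δ ha hδ hS hY y r hy hyr hgood hGY =>
      stub_cleRFccHcpOfTendsto ha hδ hS hY hy hyr hgood hGY)
    (stub_cleRTrichotomyFactor hST hTF hFFR)
  obtain ⟨φ, t, hφ, hmatch⟩ := stub_cleRHullDictionary hY
  exact ⟨(Y : Set (EuclideanSpace ℝ (Fin 3))), a, ha1, ha2, h0, ⟨φ, t, hφ, hmatch⟩, fun y hy => hclean y hy⟩

end Summit.AtomisticToContinuum.Crystallization.Theorems

end
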